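import Mathlib
import HarnessLib
import Summits.HubbardSuperconductivity.HubbardSuperconductivity.Theorems.FunctionFieldCertificateWindowInfraredBoundEngines
import Summits.HubbardSuperconductivity.HubbardSuperconductivity.Theorems.WeakCouplingBCSWcbcsSsbToTorusLROTwoParticleCost

/-!
# Crux `WindowInfraredBound` (stmt-HubbardSuperconductivity-1089) — engine B with the two-particle cost
# discharged

`wib_of_torusPairStiffness` (`FunctionFieldCertificateWindowInfraredBoundEngines.lean`, §4) derives the
crux `FunctionFieldCertificate.WindowInfraredBound` from three hypotheses: (T) the torus pair stiffness in
variational form, (Ch) the charging floor `pairGap ≥ -κ/L`, and (F3) the two-particle cost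
`|E(N_L) - E(N_L - 2)| ≤ C₃` of the `S^z = 0` sector ground energies at the summit filling
`N_L = 2⌊(1 - δ)L²/2⌋`. Hypothesis (F3) is a theorem of the tree: the sibling crux `WcbcsSsbToTorusLRO`
landed `WcbcsSsbToTorusLRO.tpc_torus_summit` (every `L ≥ 4`, constant `16 · 9 · 2 (2 + |U|)`, from the
one-particle cost on a graph of degree `≤ 4` applied twice). Here (F3) is discharged in exactly the shape
`wib_of_torusPairStiffness` consumes (`wib_twoParticleCost_holds`, with `L₀ = 4`), so that engine B rests on
the two physics inputs (T) and (Ch) alone (`wib_of_torusPairStiffness_of_chargingFloor`). Both remaining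
inputs are ground-state ENERGY statements about the doped two-dimensional Hubbard model for which no
rigorous supplier exists (no reflection positivity off half filling); nothing here claims them.

No definition, no named fact, no sorry; folklore bookkeeping over landed tree lemmas.
-/

namespace Summit.HubbardSuperconductivity.HubbardSuperconductivity.Theorems

-- summit = problem name (single-conjunct summit, D-0017): `HubbardSuperconductivity` occurs twice in the path
set_option linter.dupNamespace false

open Literature.MathematicalPhysics.QuantumLattice Literature.Probability.LatticeModels Matrix Finset
open scoped ComplexOrder ComplexConjugate
open Summit.HubbardSuperconductivity.HubbardSuperconductivity.Theses

/-- **(F3) discharged.** The two-particle cost hypothesis `hF3` of `wib_of_torusPairStiffness`, in its exact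
shape: for every `U` (the sign hypothesis `0 < U` is not used) and `δ ∈ (0, 1/2)` there are `C₃ ≥ 0` and
`L₀` (here `C₃ = 16 · 9 · 2 (2|1| + |U|)`, `L₀ = 4`) with
`|E(N_L) - E(N_L - 2)| ≤ C₃` for all `L ≥ L₀`, `E(M) = minEnergyOn (hubbardTorus 2 L 1 U) (szSector M 0)`,
`N_L = 2⌊(1 - δ)L²/2⌋` — the first conjunct of the landed `WcbcsSsbToTorusLRO.tpc_torus_summit`. [folklore] -/
theorem wib_twoParticleCost_holds :
    ∀ U : ℝ, 0 < U → ∀ δ ∈ Set.Ioo (0:ℝ) (1 / 2), ∃ C₃ : ℝ, 0 ≤ C₃ ∧ ∃ L₀ : ℕ,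
      ∀ (L : ℕ) [NeZero L], L₀ ≤ L → Even L →
        |(hubbardTorus 2 L 1 U).minEnergyOn (szSector (2 * ⌊(1 - δ) * (L : ℝ) ^ 2 / 2⌋₊) 0) -
          (hubbardTorus 2 L 1 U).minEnergyOn (szSector (2 * ⌊(1 - δ) * (L : ℝ) ^ 2 / 2⌋₊ - 2) 0)| ≤
          C₃ := by
  intro U _ δ hδ
  refine ⟨16 * (((2 * 4 + 1 : ℕ) : ℝ) * (2 * (2 * |(1 : ℝ)| + |U|))), by positivity, 4,
    fun L _ hL _ => ?_⟩
  exact (WcbcsSsbToTorusLRO.tpc_torus_summit U δ hδ L hL).1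

/-- **Engine B on two inputs.** `FunctionFieldCertificate.WindowInfraredBound` follows from
(T) the torus pair stiffness `2Re⟨w,Δ_d(m)ψ⟩ - Re⟨w,(H - E(N_L ∓ 2))w⟩ ≤ C_X L²/|q_m|²` on the
`(N_L ∓ 2, 0)` sectors for the window momenta `0 < |q_m| ≤ η`, in every normalised `(N_L, 0)`-sector
ground state `ψ` of `H = hubbardTorus 2 L 1 U` (eventually in even `L`, for all `U > 0`, `δ ∈ (0,1/2)`), and
(Ch) the charging floor `pairGap H N_L ≥ -κ/L` — the two-particle cost (F3) of `wib_of_torusPairStiffness`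
being supplied by `wib_twoParticleCost_holds`. The composition (moment closure + double-commutator and
pair-commutator budgets + Goldstone-shape lattice sum) is the landed `wib_of_torusPairStiffness`;
(T) and (Ch) are OPEN physics inputs and are hypotheses here, not claims.
Pitaevskii–Stringari, J. Low Temp. Phys. 85 (1991) 377; Kennedy–Lieb–Shastry, PRL 61 (1988) 2582. [folklore] -/
theorem wib_of_torusPairStiffness_of_chargingFloor
    (hT : ∀ U : ℝ, 0 < U → ∀ δ ∈ Set.Ioo (0:ℝ) (1 / 2), ∃ C_X η : ℝ, 0 ≤ C_X ∧ 0 < η ∧ ∃ L₀ : ℕ,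
      ∀ (L : ℕ) [NeZero L], L₀ ≤ L → Even L → ∀ ψ : Fock (Orb (FermionTorus 2 L)),
        star ψ ⬝ᵥ ψ = 1 →
          IsGroundStateInSector (hubbardTorus 2 L 1 U) (2 * ⌊(1 - δ) * (L : ℝ) ^ 2 / 2⌋₊) 0 ψ →
            ∀ m : TorusSite 2 L, m ≠ 0 → momentumNormSq L m ≤ η ^ 2 →
              (∀ w : Fock (Orb (FermionTorus 2 L)),
                w ∈ szSector (Λ := FermionTorus 2 L) (2 * ⌊(1 - δ) * (L : ℝ) ^ 2 / 2⌋₊ - 2) 0 →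
                  2 * (star w ⬝ᵥ (pairFieldAt dWaveFormFactor L m *ᵥ ψ)).re -
                    ((star w ⬝ᵥ (hubbardTorus 2 L 1 U *ᵥ w)).re -
                      (hubbardTorus 2 L 1 U).minEnergyOn
                        (szSector (2 * ⌊(1 - δ) * (L : ℝ) ^ 2 / 2⌋₊ - 2) 0) * (star w ⬝ᵥ w).re) ≤
                    C_X * (L : ℝ) ^ 2 / momentumNormSq L m) ∧
              (∀ w : Fock (Orb (FermionTorus 2 L)),
                w ∈ szSector (Λ := FermionTorus 2 L) (2 * ⌊(1 - δ) * (L : ℝ) ^ 2 / 2⌋₊ + 2) 0 →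
                  2 * (star w ⬝ᵥ ((pairFieldAt dWaveFormFactor L m)ᴴ *ᵥ ψ)).re -
                    ((star w ⬝ᵥ (hubbardTorus 2 L 1 U *ᵥ w)).re -
                      (hubbardTorus 2 L 1 U).minEnergyOn
                        (szSector (2 * ⌊(1 - δ) * (L : ℝ) ^ 2 / 2⌋₊ + 2) 0) * (star w ⬝ᵥ w).re) ≤
                    C_X * (L : ℝ) ^ 2 / momentumNormSq L m))
    (hCh : ∀ U : ℝ, 0 < U → ∀ δ ∈ Set.Ioo (0:ℝ) (1 / 2), ∃ κ : ℝ, 0 ≤ κ ∧ ∃ L₀ : ℕ,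
      ∀ (L : ℕ) [NeZero L], L₀ ≤ L → Even L →
        -(κ / (L : ℝ)) ≤ pairGap (hubbardTorus 2 L 1 U) (2 * ⌊(1 - δ) * (L : ℝ) ^ 2 / 2⌋₊)) :
    FunctionFieldCertificate.WindowInfraredBound :=
  wib_of_torusPairStiffness hT hCh wib_twoParticleCost_holds

end Summit.HubbardSuperconductivity.HubbardSuperconductivity.Theorems
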